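import Summits.SmoothPoincare4.SmoothPoincare4.Cruxes.CylinderRungTwo.IdeateSketchK1
import Literature.Geometry.Riemannian.SphericalCylinderEntropy

/-!
# Crux-triage r1/k3 evidence: the typed first lemma `FluxIdentity` of card `killing-flux` is FALSE as stated

`Sketch.FluxIdentity` (IdeateSketchK1.lean) quantifies over ALL compact `M` (no connectedness, no
`M ≃ₕ S⁴`).  Witness: `M = S⁴ ⊔ S⁴` embedded as the two slices `z₅ = 0`, `z₅ = 1`
(`CylinderSlice.twoSlices`), defining function `f z = z₅ (z₅ - 1)` (smooth, zero set in `N` = the two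
slices, `gradN f = (2 z₅ - 1) e₅ ≠ 0` there, `f > 0` for `z₅ ≥ 2`).  The typed unit normal
`unitNormalN f` is `-e₅` on the lower slice and `+e₅` on the upper one, so the flux integral is
`-μH⁴(S⁴) + μH⁴(S⁴) = 0 ≠ μH⁴(S⁴)`.  Repair: add `[ConnectedSpace M]` (or `M ≃ₕ S⁴`, as in the crux), or
require `f < 0` at the lower end; the lever of the card (flux of a CONNECTED cross-section = vol S⁴) is not
affected.
-/

noncomputable section

open scoped Manifold ContDiff Topology RealInnerProductSpace ENNReal
open Set Function MeasureTheory
open Literature.Geometry.Manifold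
open Literature.Geometry.Riemannian.SphericalCylinderEntropy

namespace Summit.SmoothPoincare4.SmoothPoincare4.Cruxes.CylinderRungTwo.Triage3

open Summit.SmoothPoincare4.SmoothPoincare4.Cruxes.CylinderRungTwo.Sketch

/-- The unit `4`-sphere of `ℝ⁵`. -/
abbrev S4 := Metric.sphere (0 : EuclideanSpace ℝ (Fin 5)) 1

/-- Defining function of the two-slice configuration: `f z = z₅ (z₅ - 1)`. -/
def f2 (z : E6) : ℝ := z 5 * (z 5 - 1)

theorem inner_axis_apply (w : E6) : ⟪axis, w⟫ = w 5 := by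
  simp [axis, EuclideanSpace.inner_single_left]

theorem norm_axis : ‖(axis : E6)‖ = 1 := by
  simp [axis]

theorem inner_axis_axis : ⟪(axis : E6), axis⟫ = 1 := by
  rw [inner_axis_apply]; simp [axis]

/-- `f2` is differentiable with derivative `(2 z₅ - 1) dz₅`. -/
theorem hasFDerivAt_f2 (z : E6) :
    HasFDerivAt f2 ((EuclideanSpace.proj (𝕜 := ℝ) (5 : Fin 6) z) • EuclideanSpace.proj (𝕜 := ℝ) (5 : Fin 6) +
      (EuclideanSpace.proj (𝕜 := ℝ) (5 : Fin 6) z - 1) • EuclideanSpace.proj (𝕜 := ℝ) (5 : Fin 6)) z := by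
  have hp : HasFDerivAt (⇑(EuclideanSpace.proj (𝕜 := ℝ) (5 : Fin 6)))
      (EuclideanSpace.proj (𝕜 := ℝ) (5 : Fin 6)) z :=
    (EuclideanSpace.proj (𝕜 := ℝ) (5 : Fin 6)).hasFDerivAt
  exact hp.mul (hp.sub_const 1)

/-- `∇ f = (2 z₅ - 1) e₅`. -/
theorem gradient_f2 (z : E6) : gradient f2 z = (2 * z 5 - 1) • axis := by
  have hf := hasFDerivAt_f2 z
  have hL : (EuclideanSpace.proj (𝕜 := ℝ) (5 : Fin 6) z) • EuclideanSpace.proj (𝕜 := ℝ) (5 : Fin 6) +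
      (EuclideanSpace.proj (𝕜 := ℝ) (5 : Fin 6) z - 1) • EuclideanSpace.proj (𝕜 := ℝ) (5 : Fin 6) =
      InnerProductSpace.toDual ℝ E6 ((2 * z 5 - 1) • axis) := by
    ext w
    rw [InnerProductSpace.toDual_apply_apply, real_inner_smul_left, inner_axis_apply]
    simp [smul_eq_mul]
    ring
  have hg : HasGradientAt f2 ((2 * z 5 - 1) • axis) z := by
    rw [hasGradientAt_iff_hasFDerivAt, ← hL]; exact hf
  exact hg.gradient

/-- The tangential gradient along `N` is the same vector (`e₅ ⊥ base z`). -/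
theorem gradN_f2 (z : E6) : gradN f2 z = (2 * z 5 - 1) • axis := by
  have hb : ⟪(axis : E6), base z⟫ = 0 := by
    rw [inner_axis_apply]
    simp [base, axis]
  rw [gradN, gradient_f2, real_inner_smul_left, hb, mul_zero, zero_smul, sub_zero]

theorem unitNormalN_f2_of_eq_zero {z : E6} (hz : z 5 = 0) : unitNormalN f2 z = -axis := by
  rw [unitNormalN, gradN_f2, hz, norm_smul, norm_axis]
  norm_num

theorem unitNormalN_f2_of_eq_one {z : E6} (hz : z 5 = 1) : unitNormalN f2 z = axis := by
  rw [unitNormalN, gradN_f2, hz, norm_smul, norm_axis]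
  norm_num

/-- The flux integrand is `-1` on the lower slice … -/
theorem integrand_lower : EqOn (fun z : E6 => ⟪axis, unitNormalN f2 z⟫) (fun _ => (-1 : ℝ))
    (Set.range (CylinderSlice.sliceMap 0)) := by
  rintro _ ⟨x, rfl⟩
  have hz : CylinderSlice.sliceMap 0 x 5 = 0 := CylinderSlice.sliceMap_apply_last 0 x
  simp only
  rw [unitNormalN_f2_of_eq_zero hz, inner_neg_right, inner_axis_axis]

/-- … and `+1` on the upper slice. -/
theorem integrand_upper : EqOn (fun z : E6 => ⟪axis, unitNormalN f2 z⟫) (fun _ => (1 : ℝ))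
    (Set.range (CylinderSlice.sliceMap 1)) := by
  rintro _ ⟨x, rfl⟩
  have hz : CylinderSlice.sliceMap 1 x 5 = 1 := CylinderSlice.sliceMap_apply_last 1 x
  simp only
  rw [unitNormalN_f2_of_eq_one hz, inner_axis_axis]

theorem disjoint_slices : Disjoint (Set.range (CylinderSlice.sliceMap 0)) (Set.range (CylinderSlice.sliceMap 1)) := by
  rw [Set.disjoint_iff]
  rintro z ⟨⟨x, rfl⟩, ⟨y, hy⟩⟩
  have h := congrArg (fun z : EuclideanSpace ℝ (Fin 6) => z 5) hy
  simp only [CylinderSlice.sliceMap_apply_last] at h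
  exact one_ne_zero h

/-- The typed flux through the two-slice configuration is `0`. -/
theorem flux_twoSlices :
    ∫ z in Set.range CylinderSlice.twoSlices, ⟪axis, unitNormalN f2 z⟫ ∂μH[4] = 0 := by
  have hrange : Set.range CylinderSlice.twoSlices =
      Set.range (CylinderSlice.sliceMap 0) ∪ Set.range (CylinderSlice.sliceMap 1) := by
    rw [CylinderSlice.twoSlices, Set.Sum.elim_range]
  have hm0 := hausdorffMeasure_range_sliceMap 0
  have hm1 := hausdorffMeasure_range_sliceMap 1
  have hfin : μH[4] (Metric.sphere (0 : EuclideanSpace ℝ (Fin 5)) 1) < ⊤ := hausdorffMeasure_sphere_four_lt_top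
  have hI0c : IntegrableOn (fun _ : E6 => (-1 : ℝ)) (Set.range (CylinderSlice.sliceMap 0)) μH[4] :=
    integrableOn_const (by rw [hm0]; exact hfin.ne)
  have hI1c : IntegrableOn (fun _ : E6 => (1 : ℝ)) (Set.range (CylinderSlice.sliceMap 1)) μH[4] :=
    integrableOn_const (by rw [hm1]; exact hfin.ne)
  have hI0 : IntegrableOn (fun z : E6 => ⟪axis, unitNormalN f2 z⟫) (Set.range (CylinderSlice.sliceMap 0)) μH[4] :=
    hI0c.congr_fun integrand_lower.symm (measurableSet_range_sliceMap 0)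
  have hI1 : IntegrableOn (fun z : E6 => ⟪axis, unitNormalN f2 z⟫) (Set.range (CylinderSlice.sliceMap 1)) μH[4] :=
    hI1c.congr_fun integrand_upper.symm (measurableSet_range_sliceMap 1)
  rw [hrange, setIntegral_union disjoint_slices (measurableSet_range_sliceMap 1) hI0 hI1,
    setIntegral_congr_fun (measurableSet_range_sliceMap 0) integrand_lower,
    setIntegral_congr_fun (measurableSet_range_sliceMap 1) integrand_upper,
    setIntegral_const, setIntegral_const]
  simp only [measureReal_def, hm0, hm1, smul_eq_mul]
  ring

/-- `f2` is a typed defining function of the two-slice configuration, positive at the upper end. -/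
theorem isDefiningFunction_f2 : IsDefiningFunction CylinderSlice.twoSlices f2 := by
  refine ⟨?_, ?_, ?_, ⟨2, ?_⟩⟩
  · have hp : ContDiff ℝ ∞ (⇑(EuclideanSpace.proj (𝕜 := ℝ) (5 : Fin 6))) :=
      (EuclideanSpace.proj (𝕜 := ℝ) (5 : Fin 6)).contDiff
    exact hp.mul (hp.sub contDiff_const)
  · intro z hz
    rw [CylinderSlice.range_twoSlices]
    simp only [Set.mem_union, Set.mem_setOf_eq, f2, mul_eq_zero, sub_eq_zero]
    have hz' : ∑ i : Fin 5, z (Fin.castSucc i) ^ 2 = 1 := hz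
    tauto
  · intro x
    rw [gradN_f2]
    have hax : (axis : E6) ≠ 0 := by
      intro h; have := norm_axis; rw [h, norm_zero] at this; exact zero_ne_one this
    rcases x with x | x
    · have hz : CylinderSlice.twoSlices (Sum.inl x) 5 = 0 := CylinderSlice.sliceMap_apply_last 0 x
      rw [hz, smul_ne_zero_iff]; norm_num; exact hax
    · have hz : CylinderSlice.twoSlices (Sum.inr x) 5 = 1 := CylinderSlice.sliceMap_apply_last 1 x
      rw [hz, smul_ne_zero_iff]; norm_num; exact hax
  · intro z _ hz
    simp only [f2]
    nlinarith

/-- **`FluxIdentity` as typed in `IdeateSketchK1.lean` is false** (two-slice cross-section `S⁴ ⊔ S⁴`). -/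
theorem fluxIdentity_false : ¬ FluxIdentity := by
  intro h
  have hsep := CylinderSlice.separatesEnds_of_slice_subset
    (A := Set.range CylinderSlice.twoSlices) (c := 0)
    (by rw [CylinderSlice.range_twoSlices]; exact Set.subset_union_left)
  have key := h (S4 ⊕ S4) CylinderSlice.twoSlices CylinderSlice.isSmoothEmbedding_twoSlices
    CylinderSlice.sum_sq_twoSlices hsep f2 isDefiningFunction_f2
  rw [flux_twoSlices] at key
  have hpos : 0 < (μH[4] (Metric.sphere (0 : EuclideanSpace ℝ (Fin 5)) 1)).toReal :=
    ENNReal.toReal_pos hausdorffMeasure_sphere_four_pos.ne' hausdorffMeasure_sphere_four_lt_top.ne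
  linarith

end Summit.SmoothPoincare4.SmoothPoincare4.Cruxes.CylinderRungTwo.Triage3
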